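import Summits.SmoothPoincare4.SmoothPoincare4.Theorems.CylinderEntropySliceIsolationOfCMS
import HarnessLib

/-!
# Route `CylinderEntropy`, crux `CylinderRungTwo` (stmt-SmoothPoincare4-7631), line `killing-flux`:
# the registered stub `stub_certMid` IS crux 7632's computational `certMid_all`

Lead reshape r15 of the crux `CylinderRungTwo` recognises the immortal leaves of its surgery tree through the conformal
domination of crux `SliceIsolation`'s line `conformal-kernel-domination`, whose mid-scale kernel certificates on `[10⁻², 10]`
are the tree's `certMid_all` (`Theorems/CylinderEntropySliceIsolationOfCMS.lean`, assembled from the `native_decide` decade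
certificates `stub_certMidA/B/C`).  The skeleton `Cruxes/CylinderRungTwo/Lines/killing_flux.lean` must keep standard axioms, so
it carries the certificates as the sorried registered stub `stub_certMid` (same signature as 7632's former `stub_certMid`); this
file discharges it by the one-line identification.  COMPUTATIONAL: the axiom closure is that of `certMid_all`
(`Lean.ofReduceBool` via `native_decide`), nothing else; no definition, no named fact.
-/

noncomputable section

-- the registered namespace repeats a component
set_option linter.dupNamespace false

open scoped BigOperators

namespace Summit.SmoothPoincare4.SmoothPoincare4.Cruxes.CylinderRungTwo.KillingFlux

/-- **Registered stub `stub_certMid` of crux stmt-SmoothPoincare4-7631 (line killing-flux, r15)** — the mid-scale kernel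
certificates on `[10⁻², 10]`: for every `T ∈ [1/100, 10]` a finite family of typed cylinder kernels of total weight `≤ 1.47`
dominates the pulled-back Euclidean Gaussian `(8π²/3)(4πT)⁻² e^{4u} e^{-(e^{2u} - 2e^u s + 1)/4T}` on `s ∈ [-1, 1]`.  Proof: the
tree's computational `certMid_all` verbatim. [folklore] -/
theorem stub_certMid :
    ∀ T : ℝ, 1 / 100 ≤ T → T ≤ 10 →
      ∃ (n : ℕ) (σ τ w : Fin n → ℝ) (c : ℝ), (∀ j, 0 < τ j) ∧ (∀ j, 0 ≤ w j) ∧ 0 ≤ c ∧ (∑ j, w j) + c ≤ 147 / 100 ∧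
        ∀ u s : ℝ, -1 ≤ s → s ≤ 1 →
          (8 * Real.pi ^ 2 / 3) * ((4 * Real.pi * T) ^ 2)⁻¹ * Real.exp (4 * u) *
              Real.exp (-(Real.exp (2 * u) - 2 * Real.exp u * s + 1) / (4 * T)) ≤
            (∑ j, w j * (Literature.Geometry.Riemannian.SphericalCylinderEntropy.zonal (τ j) s *
              Real.exp (-(u - σ j) ^ 2 / (4 * τ j)))) + c :=
  Summit.SmoothPoincare4.SmoothPoincare4.Theorems.CylinderEntropySliceIsolation.certMid_all

end Summit.SmoothPoincare4.SmoothPoincare4.Cruxes.CylinderRungTwo.KillingFlux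

end
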